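import Mathlib
import HarnessLib
import Literature.Dynamics.TransferOperators.ChangMayerEigenfunction
import Summits.RiemannHypothesis.Statement
import Summits.RiemannHypothesis.RiemannHypothesis.Theses.MayerPairing
import Summits.RiemannHypothesis.RiemannHypothesis.Theorems.MayerPairingTarget
import Summits.RiemannHypothesis.RiemannHypothesis.Theorems.MayerPairingNontrivialZeroLocus

/-!
# RiemannHypothesis / MayerPairing — the dictionary `EisensteinEigenvalueOne` (item 1469), proved

Route `RiemannHypothesis/MayerPairing`. This file closes the dictionary item
stmt-RiemannHypothesis-1469 (`EisensteinEigenvalueOne`: for `0 < Re s < 1/2` with `ζ(2s) = 0`,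
`μ = 1` is an eigenvalue of Mayer's continued transfer operator `L_s`, in the route's inlined
Lewis–Zagier/Chang–Mayer three-term form) and records its consequences for the target item
stmt-RiemannHypothesis-1473 (`Target = UnitCircleCrossedOnce ∧ BranchPairing`).

The analysis is the Literature library `Literature.Dynamics.TransferOperators` (Zagier's continued
period function `zagierPsi σ z = ∑ₘ R(σ,(m+1)z) + z^{1-σ} ζ(σ-1)/(σ-1) + ζ(σ)/2` of the Eisenstein
series, its Lewis equation on the continuation domain, `ψ(σ,1) = ζ(σ-1) ≠ 0`); here we only
bridge to the route's ζ-free predicate, whose four clauses for `f(z) = ψ(2s, z+1)`, `δ = 1` are: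
holomorphy on `Re z > -1` (`differentiableOn_zagierPsi_add_one`); non-vanishing near `0`
(`f 0 = ζ(2s-1) ≠ 0` and continuity); the three-term equation (`zagierPsi_add_one_fe`); and the
NORMALISATION `f x - f 0 (x+1)^{1-2s}/(2s-1) → 0` along the reals, which by the explicit form of
`ψ` is `∑ₘ R(2s,(m+1)(x+1)) + ζ(2s)/2 → ζ(2s)/2 = 0` (`mayerPairing_tendsto_zagierPsi_normalisation`,
from the decay bound `norm_tsum_hurwitzR_mul_le`).

* `mayerPairing_eisensteinEigenvalueOne` — `EisensteinEigenvalueOne` (the route decl, item 1469).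
* `mayerPairing_branchPairing_of_riemannHypothesis'` — RH ⇒ `BranchPairing`, now unconditional.
* `mayerPairing_target_iff_unitCircleCrossedOnce_and_riemannHypothesis` — **`Target ↔
  (UnitCircleCrossedOnce ∧ RH)`** unconditionally: the target item 1473 is exactly RH plus the
  ζ-free monotonicity crux 1470 (numerically refuted on the items; no Lean `¬` is available).

References: C.-H. Chang, D. Mayer, Contemp. Math. 290 (2001) 1–40, Prop. 4.1(v), (2.45)–(2.49),
(4.15); I. Efrat, Invent. Math. 114 (1993) 207–218; J. Lewis, D. Zagier, Ann. Math. 153 (2001) Ch. IV.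
-/

namespace Summit.RiemannHypothesis.RiemannHypothesis.Theorems

open Filter Topology
open Literature.Dynamics.TransferOperators
open Summit.RiemannHypothesis.RiemannHypothesis.Theses.MayerPairing

/-- **Normalisation of the Chang–Mayer eigenfunction along the reals.** For `σ ≠ 1` with
`Re σ > 0`: `ψ(σ, x+1) - ζ(σ-1) (x+1)^{1-σ}/(σ-1) - ζ(σ)/2 = ∑ₘ R(σ,(m+1)(x+1)) → 0` as the real
variable `x → +∞` (decay `O((x+1)^{-Re σ/2-1})` of the `m`-series). [folklore] -/
theorem mayerPairing_tendsto_tsum_hurwitzR_mul {σ : ℂ} (hσ1 : σ ≠ 1) (hσ : 0 < σ.re) :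
    Tendsto (fun x : ℝ => ∑' m : ℕ, hurwitzR σ (((m : ℂ) + 1) * ((x : ℂ) + 1))) atTop (𝓝 0) := by
  set t : ℝ := σ.re / 2 + 1 with ht
  have ht0 : 0 < t := by positivity
  set K : ℝ := trapConst σ * (∑' n : ℕ, ((n : ℝ) + 1) ^ (-t)) * (∑' m : ℕ, ((m : ℝ) + 1) ^ (-t))
    with hK
  -- the bound `‖S(x)‖ ≤ K (x+1)^{-t}` for `x ≥ 0`
  have hbound : ∀ x : ℝ, 0 ≤ x →
      ‖∑' m : ℕ, hurwitzR σ (((m : ℂ) + 1) * ((x : ℂ) + 1))‖ ≤ K * (x + 1) ^ (-t) := by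
    intro x hx
    have hz : (1 : ℝ) ≤ ((x : ℂ) + 1).re := by simp [hx]
    have h := norm_tsum_hurwitzR_mul_le (z := (x : ℂ) + 1) hσ1 hσ one_pos hz
    have hre : ((x : ℂ) + 1).re = x + 1 := by simp
    rw [hre] at h
    simpa [hK, ht, mul_assoc] using h
  have hlim : Tendsto (fun x : ℝ => K * (x + 1) ^ (-t)) atTop (𝓝 0) := by
    have h1 : Tendsto (fun x : ℝ => (x + 1) ^ (-t)) atTop (𝓝 0) :=
      (tendsto_rpow_neg_atTop ht0).comp (tendsto_atTop_add_const_right _ _ tendsto_id)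
    simpa using h1.const_mul K
  refine squeeze_zero_norm' ?_ hlim
  filter_upwards [eventually_ge_atTop (0 : ℝ)] with x hx using hbound x hx

/-- **The normalisation clause for `f(z) = ψ(σ, z+1)`.** For `0 < Re σ < 1`:
`f x - f 0 · (x+1)^{1-σ}/(σ-1) → ζ(σ)/2` along the reals (`f 0 = ψ(σ,1) = ζ(σ-1)`; the growing
terms cancel exactly). [cite: ChangMayer2001, (4.15)] -/
theorem mayerPairing_tendsto_zagierPsi_normalisation {σ : ℂ} (hσ0 : 0 < σ.re) (hσ1 : σ.re < 1) :
    Tendsto (fun x : ℝ => zagierPsi σ ((x : ℂ) + 1) -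
      zagierPsi σ 1 * ((x : ℂ) + 1) ^ (1 - σ) / (σ - 1)) atTop (𝓝 (riemannZeta σ / 2)) := by
  have hσU : σ ∈ psiDomain := ⟨hσ0, Or.inr hσ1⟩
  have hne1 : σ ≠ 1 := (ne_one_of_mem_psiDomain hσU).1
  have hdec : ∀ x : ℝ, zagierPsi σ ((x : ℂ) + 1) - zagierPsi σ 1 * ((x : ℂ) + 1) ^ (1 - σ) / (σ - 1) =
      (∑' m : ℕ, hurwitzR σ (((m : ℂ) + 1) * ((x : ℂ) + 1))) + riemannZeta σ / 2 := by
    intro x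
    rw [zagierPsi_def, zagierPsi_one hσU]
    ring
  simp_rw [hdec]
  simpa using (mayerPairing_tendsto_tsum_hurwitzR_mul hne1 hσ0).add_const (riemannZeta σ / 2)

/-- **The dictionary `EisensteinEigenvalueOne` (item stmt-RiemannHypothesis-1469), proved.** For
`0 < Re s < 1/2` with `ζ(2s) = 0`, the function `f(z) = ψ(2s, z+1)` (Zagier's continued period
function of the Eisenstein series, shifted by one) witnesses the route's inlined eigenvalue
predicate with `μ = 1` and `δ = 1`: it is holomorphic on `Re z > -1`, `f 0 = ζ(2s-1) ≠ 0` (so `f`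
does not vanish identically on `Re z > 0`), it satisfies the three-term equation
`f z - f (z+1) = (z+1)^{-2s} f (1/(z+1))`, and `f x - f 0 (x+1)^{1-2s}/(2s-1) → ζ(2s)/2 = 0`.
This is Chang–Mayer 2001, Prop. 4.1(v) (eigenvalue `+1` of Mayer's `L_s` at the zeros of
`ζ(2s)`), in the Lewis–Zagier functional-equation form. [cite: ChangMayer2001, Prop. 4.1(v)] -/
theorem mayerPairing_eisensteinEigenvalueOne : EisensteinEigenvalueOne := by
  intro s hs0 hs1 hζ
  have hσ0 : 0 < (2 * s).re := by simp; linarith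
  have hσ1 : (2 * s).re < 1 := by simp; linarith
  have hσU : 2 * s ∈ psiDomain := ⟨hσ0, Or.inr hσ1⟩
  have hne1 : 2 * s ≠ 1 := (ne_one_of_mem_psiDomain hσU).1
  -- the candidate and its holomorphy on `Re z > -1`
  have hdiff : DifferentiableOn ℂ (fun z : ℂ => zagierPsi (2 * s) (z + 1)) {z : ℂ | -(1 : ℝ) < z.re} := by
    simpa using differentiableOn_zagierPsi_add_one hne1 hσ0
  -- `f 0 = ζ(2s - 1) ≠ 0`
  have hf0 : zagierPsi (2 * s) ((0 : ℂ) + 1) = riemannZeta (2 * s - 1) := by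
    rw [zero_add, zagierPsi_one hσU]
  have hf0ne : zagierPsi (2 * s) ((0 : ℂ) + 1) ≠ 0 := by
    rw [hf0]
    exact riemannZeta_sub_one_ne_zero hσ0 hσ1
  refine ⟨fun z => zagierPsi (2 * s) (z + 1), 1, one_pos, hdiff, ?_, ?_, ?_⟩
  · -- non-vanishing at a point of the open right half-plane, by continuity at `0`
    have hopen : IsOpen {z : ℂ | -(1 : ℝ) < z.re} := isOpen_lt continuous_const Complex.continuous_re
    have h0mem : (0 : ℂ) ∈ {z : ℂ | -(1 : ℝ) < z.re} := by simp
    have hcont : ContinuousAt (fun z : ℂ => zagierPsi (2 * s) (z + 1)) 0 :=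
      (hdiff.differentiableAt (hopen.mem_nhds h0mem)).continuousAt
    have hev := hcont.eventually_ne hf0ne
    obtain ⟨ε, hε, hball⟩ := Metric.eventually_nhds_iff.1 hev
    refine ⟨((ε / 2 : ℝ) : ℂ), by simp [hε], hball ?_⟩
    rw [dist_zero_right, Complex.norm_real, Real.norm_eq_abs, abs_of_pos (by positivity)]
    linarith
  · -- the three-term functional equation (Lewis equation, continued to the strip)
    intro z hz
    have hz' : -1 < z.re := by simpa using hz
    rw [one_mul]
    exact zagierPsi_add_one_fe hσU hz'
  · -- the normalisation along the reals
    have h := mayerPairing_tendsto_zagierPsi_normalisation hσ0 hσ1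
    rw [hζ, zero_div] at h
    refine h.congr' ?_
    filter_upwards with x
    simp only [one_mul, zero_add]

/-- **RH ⇒ `BranchPairing`, unconditionally** (the dictionary hypothesis of
`mayerPairing_branchPairing_of_riemannHypothesis` is now discharged): under RH every pairing
segment degenerates to the point `ρ/2`, where `1` is an eigenvalue. [folklore] -/
theorem mayerPairing_branchPairing_of_riemannHypothesis' (hRH : _root_.Summit.RiemannHypothesis) :
    BranchPairing :=
  mayerPairing_branchPairing_of_riemannHypothesis mayerPairing_eisensteinEigenvalueOne hRH

/-- **The target is RH plus exactly the monotonicity crux, unconditionally**: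
`Target ↔ (UnitCircleCrossedOnce ∧ RH)` (dictionary and zero-locus bookkeeping both proved in
tree). So item 1473 stands or falls with item 1470 given RH, and is false as soon as
`UnitCircleCrossedOnce` is (numerical evidence on the items). [folklore] -/
theorem mayerPairing_target_iff_unitCircleCrossedOnce_and_riemannHypothesis :
    Target ↔ (UnitCircleCrossedOnce ∧ _root_.Summit.RiemannHypothesis) :=
  mayerPairing_target_iff_of_dictionary mayerPairing_eisensteinEigenvalueOne
    mayerPairing_nontrivialZeroLocus

/-- **Under RH the target IS the monotonicity crux**: `RH → (Target ↔ UnitCircleCrossedOnce)`.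
[folklore] -/
theorem mayerPairing_target_iff_unitCircleCrossedOnce_of_riemannHypothesis
    (hRH : _root_.Summit.RiemannHypothesis) : Target ↔ UnitCircleCrossedOnce :=
  ⟨fun hT => hT.1, fun hU => mayerPairing_target_of hU (mayerPairing_branchPairing_of_riemannHypothesis' hRH)⟩

end Summit.RiemannHypothesis.RiemannHypothesis.Theorems
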